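/-
Copyright (c) 2026. All rights reserved.
Released under Apache 2.0 license as described in the file LICENSE.
-/
import Literature.NumberTheory.PAdicHodge.LabelledWeightsDualProofs
import Literature.NumberTheory.PAdicHodge.DeRhamBlockTriangular
import Literature.NumberTheory.GaloisRepresentations.LabelledWeightsBlockTriangular
import Literature.NumberTheory.GaloisRepresentations.LabelledWeightsFiniteDim
import HarnessLib

/-!
# `HT_τ(ρ) = HT_τ(ρ₁) + HT_τ(ρ₂)` for a block-triangular de Rham `ρ : Γ_K → GL_{m+n}(ℚ̄_ℓ)` (pinned `B_dR`)

Topic `NumberTheory/PAdicHodge`; theorems only (no definition, no named fact, no `sorry`).  The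
accepted abstract `PeriodRingData.labelledHodgeTateWeights_blockTriangular` (labelled weights of a
block upper-triangular framed representation are the multiset sum of those of its diagonal blocks,
granted finiteness of the label components, Fontaine's dimension count and negated weights for the
three contragredients) is discharged for Fontaine's `B_dR(K)` of a non-archimedean local field
`K ⊇ ℚ_ℓ` and a DE RHAM `ρ`:

* the diagonal blocks `ρ₁` (sub) and `ρ₂` (quotient) are de Rham (accepted
  `FramedRep.IsDeRhamWith.of_blockTriangular`);
* every label component `D_τ(-)` over `ℚ̄_ℓ` is finite-dimensional (accepted
  `FramedRep.finiteDimensional_labelD_padicAlgCl`, unconditional), `dim D_τ(ρ) = m + n`,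
  `dim D_τ(ρ₁) = m`, `dim D_τ(ρ₂) = n` (accepted `IsDeRhamWith.finrank_labelD_eq`);
* `HT_τ(ρ^∨) = −HT_τ(ρ)` for the three de Rham representations (accepted
  `labelledHodgeTateWeights_dual_of_eq_bdR`).

Results: `labelledHodgeTateWeights_blockTriangular_of_eq_bdR` (any `ℚ_ℓ`-structure,
`𝔅 = bdRPeriodRingData hK`), `fontainePst_labelledHodgeTateWeights_blockTriangular` (THE pinned datum),
and for a number field and THE summit datum `fontainePstAdicCompletion v ℓ hv` at `v ∣ ℓ` with a
continuous label `τ : K_v →+* ℚ̄_ℓ`: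
`FramedGaloisRep.labelledHodgeTateWeightsAt_blockTriangular_of_isDeRhamFramed` —
**`HT_τ(ρ|_{Γ_{K_v}}) = HT_τ(ρ₁|_{Γ_{K_v}}) + HT_τ(ρ₂|_{Γ_{K_v}})`** for a global block upper-triangular
`ρ` de Rham at `v` — the weight-level form of "`D_dR` is exact with strict morphisms on de Rham
representations" (Fontaine, Exp. III Prop. 1.5.2; Brinon–Conrad §6.3).

## References
* [FontaineAsterisque223III] J.-M. Fontaine, *Représentations p-adiques semi-stables*, Astérisque 223
  (1994), Exp. III §1.5, Prop. 1.5.2.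
* [BrinonConrad2009] O. Brinon, B. Conrad, *CMI Summer School notes on p-adic Hodge theory* (2009),
  §6.3.
* [Patrikis2019] S. Patrikis, *Variations on a theorem of Tate*, Mem. AMS 258 (2019), §2.3.1, §2.7.1.
-/

noncomputable section

open scoped TensorProduct NumberField
open TensorProduct Field IsDedekindDomain ValuativeRel
open Literature.NumberTheory.GaloisRepresentations Literature.NumberTheory.Automorphic

namespace Literature.NumberTheory.PAdicHodge

-- Mathlib's own global value of `maxSynthPendingDepth` (see `LabelledWeightsTwist`); the tensor
-- types need a higher instance-synthesis budget.
set_option maxSynthPendingDepth 3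
set_option synthInstance.maxHeartbeats 200000

section Local

variable {K : Type} [Field K] [ValuativeRel K] [TopologicalSpace K] [IsNonarchimedeanLocalField K]
  [CharZero K] {ℓ : ℕ} [Fact ℓ.Prime]

/-- **`HT_τ(ρ) = HT_τ(ρ₁) + HT_τ(ρ₂)` for Fontaine's `B_dR(K)`** (any `ℚ_ℓ`-structure with `K/ℚ_ℓ`
finite; `𝔅 = bdRPeriodRingData hK`): a de Rham framed `ρ : Γ_K → GL_{m+n}(ℚ̄_ℓ)` of block
upper-triangular shape `ρ(g) = reindex (fromBlocks ρ₁(g) X(g) 0 ρ₂(g))` has labelled weights the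
multiset sum of those of its diagonal blocks, at every label `τ : K → ℚ̄_ℓ`.
[cite: FontaineAsterisque223III, Exp. III §1.5, Prop. 1.5.2] [cite: BrinonConrad2009, §6.3] [cite: Patrikis2019, §2.3.1 and §2.7.1] -/
theorem labelledHodgeTateWeights_blockTriangular_of_eq_bdR (hK : valuation K ℓ < 1)
    [Algebra ℚ_[ℓ] K] [FiniteDimensional ℚ_[ℓ] K] [Fact (¬ IsUnit ((ℓ : ℕ) : integerC K))]
    [IsAdicComplete (Ideal.span {((ℓ : ℕ) : integerC K)}) (integerC K)]
    (𝔅 : PeriodRingData.{0, 0, 0, 0} (absoluteGaloisGroup K) ℚ_[ℓ] K)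
    (h𝔅 : 𝔅 = bdRPeriodRingData (F := K) (p := ℓ) hK) {m n : ℕ}
    {ρ : FramedRep (absoluteGaloisGroup K) (PadicAlgCl ℓ) (m + n)}
    {ρ₁ : FramedRep (absoluteGaloisGroup K) (PadicAlgCl ℓ) m}
    {ρ₂ : FramedRep (absoluteGaloisGroup K) (PadicAlgCl ℓ) n}
    (X : absoluteGaloisGroup K → Matrix (Fin m) (Fin n) (PadicAlgCl ℓ))
    (hρ : ∀ g, ((ρ g : GL (Fin (m + n)) (PadicAlgCl ℓ)) :
        Matrix (Fin (m + n)) (Fin (m + n)) (PadicAlgCl ℓ)) =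
      Matrix.reindex finSumFinEquiv finSumFinEquiv
        (Matrix.fromBlocks ((ρ₁ g : GL (Fin m) (PadicAlgCl ℓ)) : Matrix (Fin m) (Fin m) (PadicAlgCl ℓ))
          (X g) 0 ((ρ₂ g : GL (Fin n) (PadicAlgCl ℓ)) : Matrix (Fin n) (Fin n) (PadicAlgCl ℓ))))
    (h : ρ.IsDeRhamWith ‹Algebra ℚ_[ℓ] K› 𝔅) (τ : K →ₐ[ℚ_[ℓ]] PadicAlgCl ℓ) :
    𝔅.labelledHodgeTateWeights (FramedRep.toContinuousRep ρ) τ.toRingHom =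
      𝔅.labelledHodgeTateWeights (FramedRep.toContinuousRep ρ₁) τ.toRingHom +
        𝔅.labelledHodgeTateWeights (FramedRep.toContinuousRep ρ₂) τ.toRingHom := by
  classical
  have hB : IsField 𝔅.B := by
    haveI := isDomain_bDeRhamPlus (F := K) (p := ℓ) (surjective_fontaineTheta_integerC hK)
    rw [h𝔅]
    exact Field.toIsField (FracBdR K ℓ)
  -- the diagonal blocks are de Rham
  obtain ⟨h₁, h₂⟩ := FramedRep.IsDeRhamWith.of_blockTriangular ‹Algebra ℚ_[ℓ] K› 𝔅 X hρ h
  -- finiteness of the six label components (unconditional over `ℚ̄_ℓ`)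
  haveI := FramedRep.finiteDimensional_labelD_padicAlgCl 𝔅 ρ τ
  haveI := FramedRep.finiteDimensional_labelD_padicAlgCl 𝔅 ρ₁ τ
  haveI := FramedRep.finiteDimensional_labelD_padicAlgCl 𝔅 ρ₂ τ
  haveI := FramedRep.finiteDimensional_labelD_padicAlgCl 𝔅 ρ.dual τ
  haveI := FramedRep.finiteDimensional_labelD_padicAlgCl 𝔅 ρ₁.dual τ
  haveI := FramedRep.finiteDimensional_labelD_padicAlgCl 𝔅 ρ₂.dual τ
  -- Fontaine's count
  have hD : Module.finrank (PadicAlgCl ℓ) (𝔅.labelD (FramedRep.toContinuousRep ρ) τ.toRingHom) =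
      Module.finrank (PadicAlgCl ℓ) (𝔅.labelD (FramedRep.toContinuousRep ρ₁) τ.toRingHom) +
        Module.finrank (PadicAlgCl ℓ) (𝔅.labelD (FramedRep.toContinuousRep ρ₂) τ.toRingHom) := by
    rw [h.finrank_labelD_eq 𝔅 hB τ, h₁.finrank_labelD_eq 𝔅 hB τ, h₂.finrank_labelD_eq 𝔅 hB τ]
  -- the contragredients have negated weights
  exact 𝔅.labelledHodgeTateWeights_blockTriangular ρ ρ₁ ρ₂ X hρ τ.toRingHom hD
    (labelledHodgeTateWeights_dual_of_eq_bdR hK 𝔅 h𝔅 h τ)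
    (labelledHodgeTateWeights_dual_of_eq_bdR hK 𝔅 h𝔅 h₁ τ)
    (labelledHodgeTateWeights_dual_of_eq_bdR hK 𝔅 h𝔅 h₂ τ)

/-- **`HT_τ(ρ) = HT_τ(ρ₁) + HT_τ(ρ₂)` for THE pinned datum** `fontainePst K ℓ hK` and a de Rham block
upper-triangular `ρ : Γ_K → GL_{m+n}(ℚ̄_ℓ)`, at every label `τ : K → ℚ̄_ℓ`.
[cite: FontaineAsterisque223III, Exp. III §1.5, Prop. 1.5.2] [cite: BrinonConrad2009, §6.3]
[cite: Patrikis2019, §2.7.1] -/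
theorem fontainePst_labelledHodgeTateWeights_blockTriangular (hK : valuation K ℓ < 1) {m n : ℕ}
    {ρ : FramedRep (absoluteGaloisGroup K) (PadicAlgCl ℓ) (m + n)}
    {ρ₁ : FramedRep (absoluteGaloisGroup K) (PadicAlgCl ℓ) m}
    {ρ₂ : FramedRep (absoluteGaloisGroup K) (PadicAlgCl ℓ) n}
    (X : absoluteGaloisGroup K → Matrix (Fin m) (Fin n) (PadicAlgCl ℓ))
    (hρ : ∀ g, ((ρ g : GL (Fin (m + n)) (PadicAlgCl ℓ)) :
        Matrix (Fin (m + n)) (Fin (m + n)) (PadicAlgCl ℓ)) =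
      Matrix.reindex finSumFinEquiv finSumFinEquiv
        (Matrix.fromBlocks ((ρ₁ g : GL (Fin m) (PadicAlgCl ℓ)) : Matrix (Fin m) (Fin m) (PadicAlgCl ℓ))
          (X g) 0 ((ρ₂ g : GL (Fin n) (PadicAlgCl ℓ)) : Matrix (Fin n) (Fin n) (PadicAlgCl ℓ))))
    (h : (fontainePst K ℓ hK).IsDeRhamFramed ρ) :
    letI := (fontainePst K ℓ hK).algebra
    ∀ τ : K →ₐ[ℚ_[ℓ]] PadicAlgCl ℓ,
      (fontainePst K ℓ hK).𝔅.labelledHodgeTateWeights (FramedRep.toContinuousRep ρ) τ.toRingHom =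
        (fontainePst K ℓ hK).𝔅.labelledHodgeTateWeights (FramedRep.toContinuousRep ρ₁) τ.toRingHom +
          (fontainePst K ℓ hK).𝔅.labelledHodgeTateWeights (FramedRep.toContinuousRep ρ₂)
            τ.toRingHom := by
  letI := (fontainePst K ℓ hK).algebra
  intro τ
  haveI : Fact (¬ IsUnit ((ℓ : ℕ) : integerC K)) := ⟨not_isUnit_natCast_integerC hK⟩
  haveI : IsAdicComplete (Ideal.span {((ℓ : ℕ) : integerC K)}) (integerC K) :=
    isAdicComplete_integerC_natCast hK
  haveI : FiniteDimensional ℚ_[ℓ] K := fontainePst_finiteDimensional hK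
  exact labelledHodgeTateWeights_blockTriangular_of_eq_bdR hK _ (fontainePst_𝔅_eq_bdRPeriodRingData hK)
    X hρ h τ

end Local

/-! ### The summit's datum at `v ∣ ℓ` -/

section NumberField

open NumberField

variable {K : Type} [Field K] [NumberField K] {ℓ : ℕ} [Fact ℓ.Prime] {m n : ℕ}

/-- **Labelled weights of a block upper-triangular global representation at a de Rham place.**  For a
number field `K`, `ρ : Γ_K →ₜ* GL_{m+n}(ℚ̄_ℓ)` with `ρ(g) = reindex (fromBlocks ρ₁(g) X(g) 0 ρ₂(g))`
(`ρ₁` a subrepresentation, `ρ₂` the quotient), a place `v ∣ ℓ` at which `ρ|_{Γ_{K_v}}` is de Rham for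
THE pinned datum `fontainePstAdicCompletion v ℓ hv`, and a continuous label `τ : K_v →+* ℚ̄_ℓ`:
**`HT_τ(ρ|_{Γ_{K_v}}) = HT_τ(ρ₁|_{Γ_{K_v}}) + HT_τ(ρ₂|_{Γ_{K_v}})`** (`FramedGaloisRep.labelledHodgeTateWeightsAt`).
[cite: FontaineAsterisque223III, Exp. III §1.5, Prop. 1.5.2] [cite: BrinonConrad2009, §6.3] [cite: Patrikis2019, §2.7.1] -/
theorem _root_.Literature.NumberTheory.GaloisRepresentations.FramedGaloisRep.labelledHodgeTateWeightsAt_blockTriangular_of_isDeRhamFramed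
    (ρ : FramedGaloisRep K (PadicAlgCl ℓ) (m + n)) (ρ₁ : FramedGaloisRep K (PadicAlgCl ℓ) m)
    (ρ₂ : FramedGaloisRep K (PadicAlgCl ℓ) n)
    (X : absoluteGaloisGroup K → Matrix (Fin m) (Fin n) (PadicAlgCl ℓ))
    (hρ : ∀ g, ((ρ g : GL (Fin (m + n)) (PadicAlgCl ℓ)) :
        Matrix (Fin (m + n)) (Fin (m + n)) (PadicAlgCl ℓ)) =
      Matrix.reindex finSumFinEquiv finSumFinEquiv
        (Matrix.fromBlocks ((ρ₁ g : GL (Fin m) (PadicAlgCl ℓ)) : Matrix (Fin m) (Fin m) (PadicAlgCl ℓ))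
          (X g) 0 ((ρ₂ g : GL (Fin n) (PadicAlgCl ℓ)) : Matrix (Fin n) (Fin n) (PadicAlgCl ℓ))))
    (v : HeightOneSpectrum (𝓞 K)) (hv : ((ℓ : ℕ) : 𝓞 K) ∈ v.asIdeal)
    (h : (fontainePstAdicCompletion v ℓ hv).IsDeRhamFramed (ρ.toLocal v))
    (τ : v.adicCompletion K →+* PadicAlgCl ℓ) (hτ : Continuous τ) :
    ρ.labelledHodgeTateWeightsAt v (fontainePstAdicCompletion v ℓ hv).algebra
        (fontainePstAdicCompletion v ℓ hv).𝔅 τ =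
      ρ₁.labelledHodgeTateWeightsAt v (fontainePstAdicCompletion v ℓ hv).algebra
          (fontainePstAdicCompletion v ℓ hv).𝔅 τ +
        ρ₂.labelledHodgeTateWeightsAt v (fontainePstAdicCompletion v ℓ hv).algebra
          (fontainePstAdicCompletion v ℓ hv).𝔅 τ := by
  haveI := LocalField.charZero_adicCompletion v
  letI := (fontainePstAdicCompletion v ℓ hv).algebra
  let τ' : v.adicCompletion K →ₐ[ℚ_[ℓ]] PadicAlgCl ℓ :=
    ⟨τ, adicCompletion_ringHom_commutes_of_continuous v hv τ hτ⟩
  have key := fontainePst_labelledHodgeTateWeights_blockTriangular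
    (LocalField.valuation_adicCompletion_natCast_lt_one v ℓ hv)
    (ρ := ρ.toLocal v) (ρ₁ := ρ₁.toLocal v) (ρ₂ := ρ₂.toLocal v)
    (fun σ => X (absGaloisRestrict K (v.adicCompletion K) σ))
    (fun σ => by simp only [FramedGaloisRep.toLocal_apply]; exact hρ _) h τ'
  rw [FramedGaloisRep.labelledHodgeTateWeightsAt_def, FramedGaloisRep.labelledHodgeTateWeightsAt_def,
    FramedGaloisRep.labelledHodgeTateWeightsAt_def]
  exact key

/-- **`card HT_τ(ρ|_{Γ_{K_v}}) = card HT_τ(ρ₁|_{Γ_{K_v}}) + card HT_τ(ρ₂|_{Γ_{K_v}})`** for a block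
upper-triangular global `ρ` de Rham at `v ∣ ℓ` and a continuous label. [cite: Patrikis2019, §2.7.1] -/
theorem _root_.Literature.NumberTheory.GaloisRepresentations.FramedGaloisRep.card_labelledHodgeTateWeightsAt_blockTriangular
    (ρ : FramedGaloisRep K (PadicAlgCl ℓ) (m + n)) (ρ₁ : FramedGaloisRep K (PadicAlgCl ℓ) m)
    (ρ₂ : FramedGaloisRep K (PadicAlgCl ℓ) n)
    (X : absoluteGaloisGroup K → Matrix (Fin m) (Fin n) (PadicAlgCl ℓ))
    (hρ : ∀ g, ((ρ g : GL (Fin (m + n)) (PadicAlgCl ℓ)) :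
        Matrix (Fin (m + n)) (Fin (m + n)) (PadicAlgCl ℓ)) =
      Matrix.reindex finSumFinEquiv finSumFinEquiv
        (Matrix.fromBlocks ((ρ₁ g : GL (Fin m) (PadicAlgCl ℓ)) : Matrix (Fin m) (Fin m) (PadicAlgCl ℓ))
          (X g) 0 ((ρ₂ g : GL (Fin n) (PadicAlgCl ℓ)) : Matrix (Fin n) (Fin n) (PadicAlgCl ℓ))))
    (v : HeightOneSpectrum (𝓞 K)) (hv : ((ℓ : ℕ) : 𝓞 K) ∈ v.asIdeal)
    (h : (fontainePstAdicCompletion v ℓ hv).IsDeRhamFramed (ρ.toLocal v))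
    (τ : v.adicCompletion K →+* PadicAlgCl ℓ) (hτ : Continuous τ) :
    Multiset.card (ρ.labelledHodgeTateWeightsAt v (fontainePstAdicCompletion v ℓ hv).algebra
        (fontainePstAdicCompletion v ℓ hv).𝔅 τ) =
      Multiset.card (ρ₁.labelledHodgeTateWeightsAt v (fontainePstAdicCompletion v ℓ hv).algebra
          (fontainePstAdicCompletion v ℓ hv).𝔅 τ) +
        Multiset.card (ρ₂.labelledHodgeTateWeightsAt v (fontainePstAdicCompletion v ℓ hv).algebra
          (fontainePstAdicCompletion v ℓ hv).𝔅 τ) := by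
  rw [ρ.labelledHodgeTateWeightsAt_blockTriangular_of_isDeRhamFramed ρ₁ ρ₂ X hρ v hv h τ hτ,
    Multiset.card_add]

/-- **Regular labelled weights of a block upper-triangular `ρ` force regular (and disjoint) labelled
weights of its diagonal blocks** at a de Rham place `v ∣ ℓ`: if `HT_τ(ρ|_{Γ_{K_v}})` is
multiplicity-free then so are `HT_τ(ρ₁|_{Γ_{K_v}})` and `HT_τ(ρ₂|_{Γ_{K_v}})`, and they are disjoint.
[cite: Patrikis2019, §2.3.1 and §2.7.1] -/
theorem _root_.Literature.NumberTheory.GaloisRepresentations.FramedGaloisRep.labelledHodgeTateWeightsAt_nodup_of_blockTriangular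
    (ρ : FramedGaloisRep K (PadicAlgCl ℓ) (m + n)) (ρ₁ : FramedGaloisRep K (PadicAlgCl ℓ) m)
    (ρ₂ : FramedGaloisRep K (PadicAlgCl ℓ) n)
    (X : absoluteGaloisGroup K → Matrix (Fin m) (Fin n) (PadicAlgCl ℓ))
    (hρ : ∀ g, ((ρ g : GL (Fin (m + n)) (PadicAlgCl ℓ)) :
        Matrix (Fin (m + n)) (Fin (m + n)) (PadicAlgCl ℓ)) =
      Matrix.reindex finSumFinEquiv finSumFinEquiv
        (Matrix.fromBlocks ((ρ₁ g : GL (Fin m) (PadicAlgCl ℓ)) : Matrix (Fin m) (Fin m) (PadicAlgCl ℓ))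
          (X g) 0 ((ρ₂ g : GL (Fin n) (PadicAlgCl ℓ)) : Matrix (Fin n) (Fin n) (PadicAlgCl ℓ))))
    (v : HeightOneSpectrum (𝓞 K)) (hv : ((ℓ : ℕ) : 𝓞 K) ∈ v.asIdeal)
    (h : (fontainePstAdicCompletion v ℓ hv).IsDeRhamFramed (ρ.toLocal v))
    (τ : v.adicCompletion K →+* PadicAlgCl ℓ) (hτ : Continuous τ)
    (hreg : (ρ.labelledHodgeTateWeightsAt v (fontainePstAdicCompletion v ℓ hv).algebra
        (fontainePstAdicCompletion v ℓ hv).𝔅 τ).Nodup) :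
    (ρ₁.labelledHodgeTateWeightsAt v (fontainePstAdicCompletion v ℓ hv).algebra
          (fontainePstAdicCompletion v ℓ hv).𝔅 τ).Nodup ∧
      (ρ₂.labelledHodgeTateWeightsAt v (fontainePstAdicCompletion v ℓ hv).algebra
          (fontainePstAdicCompletion v ℓ hv).𝔅 τ).Nodup ∧
      Disjoint (ρ₁.labelledHodgeTateWeightsAt v (fontainePstAdicCompletion v ℓ hv).algebra
          (fontainePstAdicCompletion v ℓ hv).𝔅 τ)
        (ρ₂.labelledHodgeTateWeightsAt v (fontainePstAdicCompletion v ℓ hv).algebra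
          (fontainePstAdicCompletion v ℓ hv).𝔅 τ) := by
  rw [ρ.labelledHodgeTateWeightsAt_blockTriangular_of_isDeRhamFramed ρ₁ ρ₂ X hρ v hv h τ hτ,
    Multiset.nodup_add] at hreg
  exact hreg

end NumberField

end Literature.NumberTheory.PAdicHodge

end
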